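import Literature.AnabelianGeometry.AbsoluteAnabelian.AbsTopII.DecompositionGroupsMoreover

/-!
# [AbsTopII] Prop 1.3 (iv): consequences of the trichotomy + «Moreover» clauses (PROOF-ONLY)

S. Mochizuki, *Topics in Absolute Anabelian Geometry II* [AbsTopII] (bib `MochizukiAbsTopII2013`;
kurims manuscript `paper:url-585b8d0ad0d9`), §1, Prop 1.3 (iv) pp. 11–12.

Proof-only companion (no definition) of `AbsTopII/DecompositionGroupsMoreover.lean`
(`DPSCData.Prop13iv_moreover`, abc-iut-L4-t6) over abc-iut-L4-t4's `DPSCData.Prop13iv'`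
(`AbsTopII/DecompositionGroups.lean`).  What is PROVED here, for abstract DPSC data `X`:

* `vertSub_inf_conj_le_Dv_inf_conj_inf_PiI` — `Π_v ∩ γΠ_{v′}γ⁻¹ ⊆ D_v ∩ γD_{v′}γ⁻¹ ∩ Π_I`
  (`Π_v ⊆ N_{Π_H}(Π_v) = D_v`, `Π_v ⊆ Π_𝔾 ⊆ Π_I`; no use of Prop 1.3 (v));
* `Dv_inf_conj_Dv_inf_PiI_eq_bot_of_far` — the contrapositive reading of the trichotomy: for
  `v ≠ v′` non-adjacent with no common neighbour, `D_v ∩ γD_{v′}γ⁻¹ ∩ Π_I = {1}` for every `γ ∈ Π_𝔾`;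
* `vertSub_inf_conj_vertSub_eq_bot_of_not_adjacent` — `Prop13iv'` ∧ `Prop13iv_moreover` ⊢ for
  `v ≠ v′` NON-ADJACENT, `Π_v ∩ γΠ_{v′}γ⁻¹ = {1}` for every `γ ∈ Π_𝔾` (distance 2: the printed
  "`Π_v ∩ Π_{v′} = {1}`" of situation (3); distance ≥ 3: the trichotomy);
* `vertSub_inf_conj_ne_bot_imp_eq_or_adjacent` — its contrapositive, the BASE-GRAPH form of the
  input "(A3) [AbsTopII], Proposition 1.3, (iv), or [NodNon], Proposition 3.9, (i)" of the proof of
  [IUTchI] Prop 2.1 (kurims p. 45 l. 31–35: verticial subgroups meeting non-trivially belong to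
  vertices that "are either equal or adjacent"), as consumed by abc-iut-L5's
  `IUT/HodgeTheaters/TemperedCoveringsProTree.lean` (hypothesis `hA3`, there at the level of the
  pro-`Σ̂` covering; here for the vertices of `𝔾` and `Π_𝔾`-conjugates);
* `Iv_inf_conj_Iv_eq_bot_of_ne` — the "In particular" clause read as "`v ≠ v′ ⇒ I_v ∩ γI_{v′}γ⁻¹ = {1}`".
HONEST FRAMING: consequences of typed PREDICATES (hypotheses `Prop13iv'`, `Prop13iv_moreover`),
not discharges of them; typed ≠ proved; nothing here bears on [IUTchIII] Cor 3.12.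
-/

open scoped Pointwise

universe u

namespace Literature.AnabelianGeometry.AbsoluteAnabelian

namespace DPSCData

variable (X : DPSCData.{u})

/-- `Π_v ⊆ D_v = N_{Π_H}(Π_v)` (Def 1.2 (ii)). [cite: MochizukiAbsTopII2013, Def 1.2 (ii) p.10] -/
theorem vertSub_le_Dv (v : X.Vert) : X.vertSub v ≤ X.Dv v :=
  Subgroup.le_normalizer

/-- `Π_v ⊆ Π_𝔾 ⊆ Π_I` (Def 1.2 (ii)). [cite: MochizukiAbsTopII2013, Def 1.2 (ii) p.10] -/
theorem vertSub_le_PiI (v : X.Vert) : X.vertSub v ≤ X.PiI :=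
  (X.vertSub_le v).trans X.PiG_le_PiI

/-- Monotonicity behind the use of Prop 1.3 (iv) for verticial subgroups:
`Π_v ∩ γΠ_{v′}γ⁻¹ ⊆ D_v ∩ γD_{v′}γ⁻¹ ∩ Π_I`. [cite: MochizukiAbsTopII2013, Prop 1.3 (iv) p.11] -/
theorem vertSub_inf_conj_le_Dv_inf_conj_inf_PiI (v v' : X.Vert) (γ : X.PiH) :
    X.vertSub v ⊓ MulAut.conj γ • X.vertSub v' ≤ X.Dv v ⊓ MulAut.conj γ • X.Dv v' ⊓ X.PiI :=
  le_inf
    (le_inf (inf_le_left.trans (X.vertSub_le_Dv v))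
      (inf_le_right.trans (Subgroup.pointwise_smul_le_pointwise_smul_iff.mpr (X.vertSub_le_Dv v'))))
    (inf_le_left.trans (X.vertSub_le_PiI v))

/-- If `Π_v ∩ γΠ_{v′}γ⁻¹ ≠ {1}` then `D_v ∩ γD_{v′}γ⁻¹ ∩ Π_I ≠ {1}` (the hypothesis of Prop 1.3 (iv)).
[cite: MochizukiAbsTopII2013, Prop 1.3 (iv) p.11] -/
theorem Dv_inf_conj_Dv_inf_PiI_ne_bot_of_vertSub {v v' : X.Vert} {γ : X.PiH}
    (h : X.vertSub v ⊓ MulAut.conj γ • X.vertSub v' ≠ ⊥) :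
    X.Dv v ⊓ MulAut.conj γ • X.Dv v' ⊓ X.PiI ≠ ⊥ := by
  intro hbot
  exact h (eq_bot_iff.mpr (hbot ▸ X.vertSub_inf_conj_le_Dv_inf_conj_inf_PiI v v' γ))

/-- **Trichotomy, contrapositive** (Prop 1.3 (iv) first half): if `v ≠ v′` are non-adjacent and have no
common neighbour `v″ ≠ v, v′`, then `D_v ∩ γD_{v′}γ⁻¹ ∩ Π_I = {1}` for every `γ ∈ Π_𝔾`.
[cite: MochizukiAbsTopII2013, Prop 1.3 (iv) p.11] -/
theorem Dv_inf_conj_Dv_inf_PiI_eq_bot_of_far (hiv : X.Prop13iv') {v v' : X.Vert} (hne : v ≠ v')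
    (hna : ¬ X.Adjacent v v')
    (hfar : ¬ ∃ v'' : X.Vert, v'' ≠ v ∧ v'' ≠ v' ∧ X.Adjacent v v'' ∧ X.Adjacent v'' v')
    {γ : X.PiH} (hγ : γ ∈ X.PiG) :
    X.Dv v ⊓ MulAut.conj γ • X.Dv v' ⊓ X.PiI = ⊥ := by
  by_contra h
  rcases hiv.1 v v' γ hγ h with h1 | ⟨-, h2⟩ | ⟨-, -, h3⟩
  · exact hne h1
  · exact hna h2
  · exact hfar h3

/-- **"`Π_v ∩ Π_{v′} = {1}`" for distinct non-adjacent vertices** (every `Π_𝔾`-conjugate of `Π_{v′}`):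
from the trichotomy `Prop13iv'` (distance `≥ 3`: `D_v ∩ γD_{v′}γ⁻¹ ∩ Π_I = {1}` already) and the
«Moreover» clause of situation (3) (distance `2`: the printed "`Π_v ∩ Π_{v′} = {1}`", proof p. 14).
[cite: MochizukiAbsTopII2013, Prop 1.3 (iv) p.12] -/
theorem vertSub_inf_conj_vertSub_eq_bot_of_not_adjacent (hiv : X.Prop13iv')
    (hmo : X.Prop13iv_moreover) {v v' : X.Vert} (hne : v ≠ v') (hna : ¬ X.Adjacent v v')
    {γ : X.PiH} (hγ : γ ∈ X.PiG) :
    X.vertSub v ⊓ MulAut.conj γ • X.vertSub v' = ⊥ := by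
  by_cases hfar : ∃ v'' : X.Vert, v'' ≠ v ∧ v'' ≠ v' ∧ X.Adjacent v v'' ∧ X.Adjacent v'' v'
  · obtain ⟨v'', h1, h2, h3, h4⟩ := hfar
    exact ((hmo.2 v v' v'' hne hna h1 h2 h3 h4).1 γ hγ).1
  · exact eq_bot_iff.mpr ((X.vertSub_inf_conj_le_Dv_inf_conj_inf_PiI v v' γ).trans
      (X.Dv_inf_conj_Dv_inf_PiI_eq_bot_of_far hiv hne hna hfar hγ).le)

/-- **Base-graph form of input (A3) of [IUTchI] Prop 2.1** ("[AbsTopII], Proposition 1.3, (iv), or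
[NodNon], Proposition 3.9, (i)": verticial subgroups that meet non-trivially belong to vertices that
are equal or adjacent): `Prop13iv'` ∧ `Prop13iv_moreover` ⊢ for every `γ ∈ Π_𝔾`,
`Π_v ∩ γΠ_{v′}γ⁻¹ ≠ {1} ⇒ v = v′ ∨ v, v′` adjacent. [cite: MochizukiAbsTopII2013, Prop 1.3 (iv) p.12] -/
theorem vertSub_inf_conj_ne_bot_imp_eq_or_adjacent (hiv : X.Prop13iv')
    (hmo : X.Prop13iv_moreover) {v v' : X.Vert} {γ : X.PiH} (hγ : γ ∈ X.PiG)
    (h : X.vertSub v ⊓ MulAut.conj γ • X.vertSub v' ≠ ⊥) :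
    v = v' ∨ X.Adjacent v v' := by
  by_contra hc
  push Not at hc
  exact h (X.vertSub_inf_conj_vertSub_eq_bot_of_not_adjacent hiv hmo hc.1 hc.2 hγ)

/-- The "In particular" clause of Prop 1.3 (iv) read as "`v ≠ v′ ⇒ I_v ∩ γI_{v′}γ⁻¹ = {1}`"
(every `γ ∈ Π_𝔾`). [cite: MochizukiAbsTopII2013, Prop 1.3 (iv) p.12] -/
theorem Iv_inf_conj_Iv_eq_bot_of_ne (hiv : X.Prop13iv') {v v' : X.Vert} (hne : v ≠ v')
    {γ : X.PiH} (hγ : γ ∈ X.PiG) :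
    X.Iv v ⊓ MulAut.conj γ • X.Iv v' = ⊥ := by
  by_contra h
  exact hne (hiv.2 v v' γ hγ h)

/-- Situation (2), the configured pair: for adjacent `v ≠ v′` joined by the node `e`, the «Moreover»
clause produces `Π_𝔾`-conjugates with `D_v ∩ γD_{v′}γ⁻¹ ∩ Π_I = δI_eδ⁻¹`; in particular that
intersection is NON-trivial as soon as `I_e ≠ {1}` — the configuration realising the hypothesis of
the trichotomy in case (2). [cite: MochizukiAbsTopII2013, Prop 1.3 (iv) p.12] -/
theorem exists_Dv_inf_conj_Dv_inf_PiI_ne_bot_of_adjacent (hmo : X.Prop13iv_moreover)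
    {v v' : X.Vert} {e : X.Node} (hne : v ≠ v') (hv : X.nodeAbuts e v) (hv' : X.nodeAbuts e v')
    (hIe : X.IvNode e ≠ ⊥) :
    ∃ γ : X.PiH, γ ∈ X.PiG ∧ X.Dv v ⊓ MulAut.conj γ • X.Dv v' ⊓ X.PiI ≠ ⊥ := by
  obtain ⟨γ, hγ, -, δ, -, hδ⟩ := hmo.1 v v' e hne hv hv'
  refine ⟨γ, hγ, ?_⟩
  rw [hδ]
  intro h
  apply hIe
  have : (MulAut.conj δ)⁻¹ • (MulAut.conj δ • X.IvNode e) = ⊥ := by rw [h, Subgroup.smul_bot]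
  rwa [inv_smul_smul] at this

end DPSCData

end Literature.AnabelianGeometry.AbsoluteAnabelian
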